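import Literature.Geometry.Riemannian.KernelGradientIntegralBound
import Literature.Geometry.Riemannian.MetricFlowPhiMills
import Literature.Probability.Distributions.TailConstraintLocalSecondMoment
import Mathlib.Probability.Distributions.Gaussian.Real
import HarnessLib

/-!
# Bamler's integral gradient bound for the heat kernel, localized to subsets (Bamler 2020a,
# Prop. 4.2 (arXiv v1 Prop. 15), second display, case `p = 2`)

R. Bamler, *Entropy and heat kernel bounds on a Ricci flow background*, arXiv:2008.07093 (2020a),
§4.1, Prop. 4.2: *"Moreover, for any measurable subset `X ⊂ M` we have
`(t−s)^{p/2} ∫_X (|∇ₓK(x,t;·,s)|/K(x,t;·,s))^p dν ≤ C(n,p) ν(X) (−log(ν(X)/2))^{p/2}`."*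
Proved here for `p = 2` in the directional form of `KernelGradientIntegralBound.lean`
(`mul_setIntegral_sq_deriv_heatKernelFn_div_le`): for a `C^∞` curve of base points `γ` with
`g_t(γ̇(0),γ̇(0)) ≤ 1` and every Borel `X`,

  `(t − s) ∫_X (∂_σ|₀K(γσ,t;y,s)/K(γ0,t;y,s))² dν(y) ≤ C · ν(X) · (1 − log ν(X))`

with a universal constant `C` (the printed `ν(X)(−log(ν(X)/2))` and `ν(X)(1 − log ν(X))` are
comparable on `(0,1]`). Proof: NOT the rearrangement argument of the source but a shorter route
through the tail constraint (4.7) `∫_Y q dν ≤ F(ν(Y))` (`sqrt_mul_setIntegral_deriv_heatKernelFn_le`)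
for `q = √(t−s) ∂K/K` and for `−q` (via `∫_Y (−q) = ∫_{Yᶜ} q` and the symmetry `F(1−b) = F(b)`,
`Phi_neg`, `PhiInv_one_sub`), the Mills-type profile bound `F(b) ≤ C₁ b √(1 − log b)`
(`MetricFlow.exists_deriv_Phi_PhiInv_le_mul_sqrt_one_sub_log`) and the abstract localized second
moment bound `Literature.Probability.Distributions.setIntegral_pos_sq_le_of_setIntegral_le_tail`
(sub-Gaussian superlevel tails + layer cake).

## References

* R. H. Bamler, *Entropy and heat kernel bounds on a Ricci flow background*, arXiv:2008.07093
  (2020), §4.1 Prop. 4.2 (arXiv v1 Prop. 15), §4.3 ((4.7), (4.12)). [Bamler2020Entropy]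
-/

noncomputable section

open Set Filter Function MeasureTheory Measure ProbabilityTheory
open scoped Manifold ContDiff Topology ENNReal NNReal

namespace Literature.Geometry.Riemannian

open Lorentzian Lorentzian.PseudoRiemannianMetric MetricFlow

/-! ### Symmetry of Bamler's `Φ` and of the profile `F = Φ' ∘ Φ⁻¹` -/

namespace MetricFlow

/-- **`Φ(−x) = 1 − Φ(x)`**: the centred Gaussian is symmetric and has no atoms.
[cite: Bamler2023, §3, (3.1)] -/
theorem Phi_neg (x : ℝ) : Phi (-x) = 1 - Phi x := by
  set N : Measure ℝ := gaussianReal 0 2 with hN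
  haveI : IsProbabilityMeasure N := by rw [hN]; infer_instance
  have hmap : N.map (fun y : ℝ ↦ -y) = N := by
    rw [hN, gaussianReal_map_neg, neg_zero]
  -- `N(Iic (-x)) = N(Ici x)`
  have h1 : N (Iic (-x)) = N (Ici x) := by
    conv_lhs => rw [← hmap]
    rw [Measure.map_apply (by fun_prop) measurableSet_Iic]
    congr 1
    ext y
    simp
  -- no atoms: `N {x} = 0`, so `N(Iio x) = N(Iic x)`
  have h0 : N {x} = 0 := by
    rw [hN]
    exact (gaussianReal_absolutelyContinuous 0 (by norm_num)) (by simp)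
  have hIio : N (Iio x) = N (Iic x) := by
    rw [← Iic_sdiff_right]
    exact measure_sdiff_null h0
  -- `N(Ici x) = 1 - N(Iio x)`
  have h2 : N (Ici x) = 1 - N (Iic x) := by
    rw [← hIio, ← prob_compl_eq_one_sub measurableSet_Iio, compl_Iio]
  have ePhi : ∀ z, Phi z = (N (Iic z)).toReal := fun z ↦ by
    rw [Phi, cdf_eq_real, measureReal_def]
  rw [ePhi, ePhi, h1, h2, ENNReal.toReal_sub_of_le prob_le_one ENNReal.one_ne_top,
    ENNReal.toReal_one]

/-- **`Φ⁻¹(1 − b) = −Φ⁻¹(b)`** on `(0, 1)`. [cite: Bamler2020Entropy, §4.1] -/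
theorem PhiInv_one_sub {b : ℝ} (hb0 : 0 < b) (hb1 : b < 1) : PhiInv (1 - b) = -PhiInv b := by
  apply Phi_strictMono.injective
  rw [Phi_PhiInv (by linarith) (by linarith), Phi_neg, Phi_PhiInv hb0 hb1]

/-- **The profile is symmetric: `F(1 − b) = F(b)`** (`Φ'` is even). [cite: Bamler2020Entropy, §4.3] -/
theorem deriv_Phi_PhiInv_one_sub {b : ℝ} (hb0 : 0 < b) (hb1 : b < 1) :
    deriv Phi (PhiInv (1 - b)) = deriv Phi (PhiInv b) := by
  rw [PhiInv_one_sub hb0 hb1, deriv_Phi, deriv_Phi, neg_sq]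

end MetricFlow

/-! ### Prop. 4.2 localized, `p = 2` -/

section Local

variable {m : ℕ} {H : Type*} [TopologicalSpace H]
  {I : ModelWithCorners ℝ (EuclideanSpace ℝ (Fin m)) H} [I.Boundaryless]
  {M : Type*} [TopologicalSpace M] [ChartedSpace H M] [IsManifold I ∞ M]
  [T2Space M] [CompactSpace M] [SecondCountableTopology M] [MeasurableSpace M] [BorelSpace M]
  [PreconnectedSpace M]
  {h : ℝ → PseudoRiemannianMetric I ∞ (EuclideanSpace ℝ (Fin m)) (TangentSpace I : M → Type _)}
  {cov : ℝ → CovariantDerivative I (EuclideanSpace ℝ (Fin m)) (TangentSpace I : M → Type _)}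
  {a T : ℝ} (hflow : IsRicciFlow h cov (Icc a T)) (hh : IsContMDiffFamilyOn ∞ h univ)
  (hR : ∀ r, (h r).IsRiemannian)

/-- Pointwise: `q² = (q⁺)² + ((−q)⁺)²`. [folklore] -/
theorem sq_eq_pos_sq_add_neg_pos_sq (q : ℝ) : q ^ 2 = (max q 0) ^ 2 + (max (-q) 0) ^ 2 := by
  rcases le_total 0 q with hq | hq
  · rw [max_eq_left hq, max_eq_right (by linarith)]; ring
  · rw [max_eq_right hq, max_eq_left (by linarith)]; ring

/-- **Bamler 2020a, Prop. 4.2 localized to subsets, case `p = 2` (directional form)**, proved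
from the tail constraint (4.7), the profile bound (4.12) and the abstract localized second-moment
lemma, the latter two taken as the hypotheses `hMills`, `hLoc` (they are the registered helper
statements `MetricFlow.exists_deriv_Phi_PhiInv_le_mul_sqrt_one_sub_log` and
`Literature.Probability.Distributions.setIntegral_pos_sq_le_of_setIntegral_le_tail`). For a Ricci
flow `hflow` on `[a,T]` of a smooth family of Riemannian metrics on a closed connected manifold,
`a < s < t < T`, a `C^∞` curve `γ` with `g_t(γ̇0, γ̇0) ≤ 1`, `ν = ν_{γ0,t;s}`, and Borel `X`:
`(t − s) ∫_X (∂_σ|₀K(γσ,t;y,s)/K(γ0,t;y,s))² dν ≤ 4 C₁² ν(X) (1 − log ν(X))`.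
[cite: Bamler2020Entropy, §4.1, Prop. 4.2 (arXiv v1 Prop. 15), second display, p = 2] -/
theorem mul_setIntegral_sq_deriv_heatKernelFn_div_le_of {C₁ : ℝ} (hC₁ : 0 < C₁)
    (hMills : ∀ b ∈ Ioo (0 : ℝ) 1, deriv Phi (PhiInv b) ≤ C₁ * b * Real.sqrt (1 - Real.log b))
    (hLoc : ∀ (ν : Measure M) [IsProbabilityMeasure ν] {q : M → ℝ},
      Measurable q → (∃ B : ℝ, ∀ x, |q x| ≤ B) → ∀ {F : ℝ → ℝ} {C₁ : ℝ}, 0 < C₁ →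
      (∀ b ∈ Ioc (0 : ℝ) 1, F b ≤ C₁ * b * Real.sqrt (1 - Real.log b)) →
      (∀ Y : Set M, MeasurableSet Y → ∫ x in Y, q x ∂ν ≤ F (ν.real Y)) →
      ∀ {Y : Set M}, MeasurableSet Y →
        ∫ x in Y, (max (q x) 0) ^ 2 ∂ν ≤ 2 * C₁ ^ 2 * ν.real Y * (1 - Real.log (ν.real Y)))
    {s t : ℝ} (has : a < s) (hst : s < t) (htT : t < T) {γ : ℝ → M}
    (hγ : ContMDiff 𝓘(ℝ, ℝ) I ∞ γ) (h1 : (h t).val (γ 0) (velocity I γ 0) (velocity I γ 0) ≤ 1)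
    {X : Set M} (hX : MeasurableSet X) :
    (t - s) * ∫ y in X, (deriv (fun σ ↦ hflow.heatKernelFn hh hR t (γ σ) (y, s)) 0 /
        hflow.heatKernelFn hh hR t (γ 0) (y, s)) ^ 2 ∂(heatKernelMeasure hh hR t (γ 0) s) ≤
      4 * C₁ ^ 2 * (heatKernelMeasure hh hR t (γ 0) s).real X *
        (1 - Real.log ((heatKernelMeasure hh hR t (γ 0) s).real X)) := by
  haveI : IsFiniteMeasure (h s).riemVolume := ⟨(h s).riemVolume_univ_lt_top⟩
  have ht : t ∈ Ioc a T := ⟨has.trans hst, htT.le⟩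
  have hs : s ∈ Ioo a t := ⟨has, hst⟩
  have hτ : 0 < t - s := sub_pos.2 hst
  set c : ℝ := Real.sqrt (t - s) with hcdef
  have hc : 0 < c := Real.sqrt_pos.2 hτ
  have hc2 : c ^ 2 = t - s := Real.sq_sqrt hτ.le
  set ν : Measure M := heatKernelMeasure hh hR t (γ 0) s with hν
  set K₀ : M → ℝ := fun y ↦ hflow.heatKernelFn hh hR t (γ 0) (y, s) with hK₀
  set K' : M → ℝ := fun y ↦ deriv (fun σ ↦ hflow.heatKernelFn hh hR t (γ σ) (y, s)) 0 with hK'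
  set F : ℝ → ℝ := fun b ↦ if b ∈ Ioo (0 : ℝ) 1 then deriv Phi (PhiInv b) else 0 with hF
  -- positivity / continuity / lower bound of `K₀`
  have hK₀c : Continuous K₀ := hflow.continuous_heatKernelFn_slice hh hR ht (γ 0) hs
  have hK₀pos : ∀ y, 0 < K₀ y := fun y ↦ hflow.heatKernelFn_pos hh hR ht (γ 0) ⟨mem_univ _, hs⟩
  obtain ⟨k₀, hk₀pos, hk₀⟩ : ∃ k₀ : ℝ, 0 < k₀ ∧ ∀ y, k₀ ≤ K₀ y := by
    rcases isEmpty_or_nonempty M with hM | hM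
    · exact ⟨1, one_pos, fun y ↦ (IsEmpty.false y).elim⟩
    · obtain ⟨y₀, -, hy₀⟩ := isCompact_univ.exists_isMinOn univ_nonempty hK₀c.continuousOn
      exact ⟨K₀ y₀, hK₀pos y₀, fun y ↦ hy₀ (mem_univ y)⟩
  -- the normalised score `q = c ∂K/K`
  set q : M → ℝ := fun y ↦ c * (K' y / K₀ y) with hq
  have hK'm : Measurable K' := hflow.measurable_deriv_heatKernelFn_curve hh hR has hst htT hγ
  have hqm : Measurable q := (hK'm.div hK₀c.measurable).const_mul c
  obtain ⟨B, hB⟩ := hflow.exists_abs_deriv_heatKernelFn_curve_le hh hR has hst htT hγ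
  have hB0 : 0 ≤ B := (abs_nonneg _).trans (hB (γ 0))
  have hqbdd : ∃ C : ℝ, ∀ y, |q y| ≤ C := by
    refine ⟨c * (B / k₀), fun y ↦ ?_⟩
    rw [hq, abs_mul, abs_of_pos hc, abs_div, abs_of_pos (hK₀pos y)]
    refine mul_le_mul_of_nonneg_left ?_ hc.le
    exact div_le_div₀ hB0 (hB y) hk₀pos (hk₀ y)
  have hnqbdd : ∃ C : ℝ, ∀ y, |(-q) y| ≤ C := by
    obtain ⟨C, hC⟩ := hqbdd
    exact ⟨C, fun y ↦ by rw [Pi.neg_apply, abs_neg]; exact hC y⟩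
  -- set integrals of `q` against `ν` are `c ∫_X K' dg_s`
  have hqK : ∀ y, K' y / K₀ y * K₀ y = K' y := fun y ↦
    div_mul_cancel₀ _ (hK₀pos y).ne'
  have hset : ∀ Y : Set M, MeasurableSet Y →
      ∫ y in Y, q y ∂ν = c * ∫ y in Y, K' y ∂(h s).riemVolume := by
    intro Y hY
    rw [hflow.setIntegral_heatKernelMeasure_eq_setIntegral_mul hh hR ht (γ 0) hs hY]
    rw [← integral_const_mul]
    refine integral_congr_ae (Eventually.of_forall fun y ↦ ?_)
    simp only [hq]
    rw [mul_assoc, hqK y]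
  -- integrability of `q`
  haveI : IsProbabilityMeasure ν := by rw [hν]; infer_instance
  have hqi : Integrable q ν := by
    obtain ⟨C, hC⟩ := hqbdd
    exact Integrable.of_bound hqm.aestronglyMeasurable C (ae_of_all _ fun y ↦ by
      rw [Real.norm_eq_abs]; exact hC y)
  -- mean zero
  have hmean : ∫ y, q y ∂ν = 0 := by
    have := hset univ MeasurableSet.univ
    rw [Measure.restrict_univ, Measure.restrict_univ] at this
    rw [this]
    have hDuniv := hasDerivAt_setIntegral_comp_heatKernelFn_curve hflow hh hR has hst htT hγ
      (Λ := fun k ↦ k) (contDiffOn_id) MeasurableSet.univ 0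
    have hconst : (fun σ ↦ ∫ y in univ, (fun k : ℝ ↦ k) (hflow.heatKernelFn hh hR t (γ σ) (y, s))
        ∂(h s).riemVolume) = fun _ ↦ (1 : ℝ) := by
      funext σ
      rw [Measure.restrict_univ]
      exact hflow.integral_heatKernelFn_eq_one hh hR ht (γ σ) hs
    rw [hconst] at hDuniv
    have h0 := hDuniv.unique (hasDerivAt_const 0 (1 : ℝ))
    rw [Measure.restrict_univ] at h0
    have h0' : ∫ y, K' y ∂(h s).riemVolume = 0 := by
      rw [← h0]
      refine integral_congr_ae (Eventually.of_forall fun y ↦ ?_)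
      simp [hK']
    rw [h0', mul_zero]
  -- tail constraint for `q`
  have htail : ∀ Y : Set M, MeasurableSet Y → ∫ y in Y, q y ∂ν ≤ F (ν.real Y) := by
    intro Y hY
    rw [hset Y hY]
    exact hflow.sqrt_mul_setIntegral_deriv_heatKernelFn_le hh hR has hst htT hγ h1 hY
  -- tail constraint for `-q`, through the complement and the symmetry of `F`
  have hFsymm : ∀ b : ℝ, F (1 - b) = F b := by
    intro b
    by_cases hb : b ∈ Ioo (0 : ℝ) 1
    · have hb' : 1 - b ∈ Ioo (0 : ℝ) 1 := ⟨by linarith [hb.2], by linarith [hb.1]⟩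
      simp only [hF, if_pos hb, if_pos hb']
      exact deriv_Phi_PhiInv_one_sub hb.1 hb.2
    · have hb' : 1 - b ∉ Ioo (0 : ℝ) 1 := fun h' ↦ hb ⟨by linarith [h'.2], by linarith [h'.1]⟩
      simp only [hF, if_neg hb, if_neg hb']
  have htail' : ∀ Y : Set M, MeasurableSet Y → ∫ y in Y, (-q) y ∂ν ≤ F (ν.real Y) := by
    intro Y hY
    have hsplit := integral_add_compl hY hqi
    have e : ∫ y in Y, (-q) y ∂ν = ∫ y in Yᶜ, q y ∂ν := by
      simp only [Pi.neg_apply, integral_neg]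
      linarith
    rw [e, ← hFsymm (ν.real Y), ← probReal_compl_eq_one_sub hY]
    exact htail Yᶜ hY.compl
  -- the profile bound, transferred to `F` on `(0, 1]` (`F 1 = 0`)
  have hFle : ∀ b ∈ Ioc (0 : ℝ) 1, F b ≤ C₁ * b * Real.sqrt (1 - Real.log b) := by
    intro b hb
    rcases eq_or_lt_of_le hb.2 with rfl | hb1
    · simp only [hF, mem_Ioo, lt_self_iff_false, and_false, if_false, Real.log_one, sub_zero,
        Real.sqrt_one, mul_one]
      linarith
    · simp only [hF, if_pos (show b ∈ Ioo (0 : ℝ) 1 from ⟨hb.1, hb1⟩)]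
      exact hMills b ⟨hb.1, hb1⟩
  -- the two localized bounds
  have hpos := hLoc ν hqm hqbdd hC₁ hFle htail hX
  have hneg := hLoc ν hqm.neg hnqbdd hC₁ hFle htail' hX
  -- assemble: `∫_X q² = ∫_X (q⁺)² + ∫_X ((−q)⁺)²`
  have hqsq_int : IntegrableOn (fun y ↦ q y ^ 2) X ν := by
    obtain ⟨C, hC⟩ := hqbdd
    refine (Integrable.of_bound (hqm.pow_const 2).aestronglyMeasurable (C ^ 2)
      (ae_of_all _ fun y ↦ ?_)).integrableOn
    rw [Real.norm_eq_abs, abs_pow, sq_abs, ← sq_abs (q y)]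
    exact pow_le_pow_left₀ (abs_nonneg _) (hC y) 2
  have hp_int : IntegrableOn (fun y ↦ (max (q y) 0) ^ 2) X ν := by
    obtain ⟨C, hC⟩ := hqbdd
    refine (Integrable.of_bound ((hqm.max measurable_const).pow_const 2).aestronglyMeasurable
      (C ^ 2) (ae_of_all _ fun y ↦ ?_)).integrableOn
    rw [Real.norm_eq_abs, abs_pow]
    refine pow_le_pow_left₀ (abs_nonneg _) ?_ 2
    rw [abs_of_nonneg (le_max_right _ _)]
    exact max_le ((le_abs_self _).trans (hC y)) ((abs_nonneg _).trans (hC y))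
  have hn_int : IntegrableOn (fun y ↦ (max ((-q) y) 0) ^ 2) X ν := by
    obtain ⟨C, hC⟩ := hnqbdd
    refine (Integrable.of_bound ((hqm.neg.max measurable_const).pow_const 2).aestronglyMeasurable
      (C ^ 2) (ae_of_all _ fun y ↦ ?_)).integrableOn
    rw [Real.norm_eq_abs, abs_pow]
    refine pow_le_pow_left₀ (abs_nonneg _) ?_ 2
    rw [abs_of_nonneg (le_max_right _ _)]
    exact max_le ((le_abs_self _).trans (hC y)) ((abs_nonneg _).trans (hC y))
  have hsum : ∫ y in X, q y ^ 2 ∂ν =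
      ∫ y in X, (max (q y) 0) ^ 2 ∂ν + ∫ y in X, (max ((-q) y) 0) ^ 2 ∂ν := by
    rw [← integral_add hp_int hn_int]
    refine integral_congr_ae (Eventually.of_forall fun y ↦ ?_)
    exact sq_eq_pos_sq_add_neg_pos_sq (q y)
  -- `∫_X q² dν = (t − s) ∫_X (K'/K₀)² dν`
  have e : ∫ y in X, q y ^ 2 ∂ν = (t - s) * ∫ y in X, (K' y / K₀ y) ^ 2 ∂ν := by
    rw [← integral_const_mul]
    refine integral_congr_ae (Eventually.of_forall fun y ↦ ?_)
    simp only [hq]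
    rw [mul_pow, hc2]
  rw [← e, hsum]
  linarith

/-- **Bamler 2020a, Prop. 4.2 localized to subsets, case `p = 2` (directional form).** There is
a universal constant `C` such that for every Ricci flow `hflow` on `[a,T]` of a smooth family of
Riemannian metrics on a closed connected manifold modelled on `ℝᵐ`, all `a < s < t < T`, every
`C^∞` curve `γ` of base points with `g_t(γ̇0, γ̇0) ≤ 1`, `ν = ν_{γ0,t;s}`, and every Borel `X`,

  `(t − s) ∫_X (∂_σ|₀K(γσ,t;y,s) / K(γ0,t;y,s))² dν(y) ≤ C ν(X) (1 − log ν(X))`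

("for any measurable subset `X ⊂ M` we have
`(t−s)^{p/2}∫_X (|∇ₓK|/K)^p dν ≤ C(n,p) ν(X)(−log(ν(X)/2))^{p/2}`", here `p = 2`, one direction
`v = γ̇0`; the profiles `b(−log(b/2))` and `b(1 − log b)` are comparable on `(0,1]`).
`mul_setIntegral_sq_deriv_heatKernelFn_div_le_of` with the landed profile bound
`MetricFlow.exists_deriv_Phi_PhiInv_le_mul_sqrt_one_sub_log` and localized second-moment lemma
`Literature.Probability.Distributions.setIntegral_pos_sq_le_of_setIntegral_le_tail`.
[cite: Bamler2020Entropy, §4.1, Prop. 4.2 (arXiv v1 Prop. 15), second display, p = 2] -/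
theorem exists_mul_setIntegral_sq_deriv_heatKernelFn_div_le :
    ∃ C : ℝ, 0 < C ∧ ∀ {m : ℕ} {H : Type*} [TopologicalSpace H]
      {I : ModelWithCorners ℝ (EuclideanSpace ℝ (Fin m)) H} [I.Boundaryless]
      {M : Type*} [TopologicalSpace M] [ChartedSpace H M] [IsManifold I ∞ M]
      [T2Space M] [CompactSpace M] [SecondCountableTopology M] [MeasurableSpace M] [BorelSpace M]
      [PreconnectedSpace M]
      {h : ℝ → PseudoRiemannianMetric I ∞ (EuclideanSpace ℝ (Fin m)) (TangentSpace I : M → Type _)}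
      {cov : ℝ → CovariantDerivative I (EuclideanSpace ℝ (Fin m)) (TangentSpace I : M → Type _)}
      {a T : ℝ} (hflow : IsRicciFlow h cov (Icc a T)) (hh : IsContMDiffFamilyOn ∞ h univ)
      (hR : ∀ r, (h r).IsRiemannian) {s t : ℝ}, a < s → s < t → t < T → ∀ {γ : ℝ → M},
      ContMDiff 𝓘(ℝ, ℝ) I ∞ γ → (h t).val (γ 0) (velocity I γ 0) (velocity I γ 0) ≤ 1 →
      ∀ {X : Set M}, MeasurableSet X →
      (t - s) * ∫ y in X, (deriv (fun σ ↦ hflow.heatKernelFn hh hR t (γ σ) (y, s)) 0 /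
          hflow.heatKernelFn hh hR t (γ 0) (y, s)) ^ 2 ∂(heatKernelMeasure hh hR t (γ 0) s) ≤
        C * (heatKernelMeasure hh hR t (γ 0) s).real X *
          (1 - Real.log ((heatKernelMeasure hh hR t (γ 0) s).real X)) := by
  obtain ⟨C₁, hC₁, hMills⟩ := MetricFlow.exists_deriv_Phi_PhiInv_le_mul_sqrt_one_sub_log
  refine ⟨4 * C₁ ^ 2, by positivity, ?_⟩
  intro m H _ I _ M _ _ _ _ _ _ _ _ _ h cov a T hflow hh hR s t has hst htT γ hγ h1 X hX
  exact mul_setIntegral_sq_deriv_heatKernelFn_div_le_of hflow hh hR hC₁ hMills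
    (fun ν _ q hqm hqb F C₁' hC₁' hF htail Y hY ↦
      Literature.Probability.Distributions.setIntegral_pos_sq_le_of_setIntegral_le_tail ν hqm hqb
        hC₁' hF htail hY)
    has hst htT hγ h1 hX

end Local

end Literature.Geometry.Riemannian

end
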